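import Mathlib.Topology.Connected.LocallyConnected
import Mathlib.Topology.Algebra.InfiniteSum.ENNReal
import Mathlib.Analysis.SpecialFunctions.Trigonometric.Basic
import Mathlib.Analysis.Real.Sqrt
import Mathlib.Data.Setoid.Basic
import Mathlib.SetTheory.Cardinal.Finite
import Literature.Geometry.Lorentzian.LorentzianMetric
import Literature.Geometry.Lorentzian.Causality
import Literature.Geometry.Lorentzian.CausalFutureProofs
import HarnessLib

/-!
# Horizon lineages: descent of black holes between two cuts, the merger partition,
# irreducible masses and the ℓ²-over-blocks cost

Hawking–Ellis (1973, §9.2, p. 315) define a *black hole* on a slice `𝒮(τ)` of a future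
asymptotically predictable space-time as a connected component of
`ℬ(τ) = 𝒮(τ) ∖ J⁻(𝓘⁺)`, and prove that, as `τ` increases, black holes may merge and new ones may
form but **can never bifurcate** (Prop. 9.2.5: if the black holes `ℬ₂(τ₂)`, `ℬ₃(τ₂)` on a later
slice both meet `J⁺(ℬ₁(τ₁))`, then `ℬ₂(τ₂) = ℬ₃(τ₂)`; the proof is that
`J⁺(ℬ₁(τ₁)) ∩ 𝒮(τ₂)` is nonempty — every timelike curve from `ℬ₁(τ₁)` meets the later slice —
and connected, hence inside one component of `ℬ(τ₂)`), and the **area theorem per lineage**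
(Prop. 9.2.7: the area of `∂ℬ₁(τ)` is at least the sum of the areas of the `∂ℬᵢ(τ')`, `τ' < τ`,
over the earlier holes with `J⁺(ℬᵢ(τ')) ∩ ℬ₁(τ) ≠ ∅`; the regularity-free area theorem is
Chruściel–Delay–Galloway–Howard 2001, Thm. 1.1 and its local form Thm. 6.1).

This file vendors the **bookkeeping** of that picture — the *lineage* (descent) structure between
the components of an earlier cut `C` and a later cut `C'` — abstractly, so that it can be
instantiated both on Hawking–Ellis' black-hole regions `ℬ(τ) ⊆ 𝒮(τ)` and on cuts `𝓗⁺ ∩ Σ` of an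
event horizon by slices or hyperboloidal leaves (definition request `defn-HorizonLineage` of route
`MergerLatticeBudget`, Final State Conjecture; the event horizon and the areas of its cuts are the
separate request `defn-EventHorizonCuts`). The data are: a topological space `M` (the space-time
manifold), an operator `J : Set M → Set M` (the causal future `J⁺`; for a `Spacetime` it is
`S.metric.causalFuture S.timeOrientation`), two subsets `C C' : Set M` (the cuts, `C'` the later
one) and, for the area statements, a set function `area : Set M → ℝ≥0∞`.

* `HorizonLineage.carrier C K ⊆ M`: the underlying set of the component
  `K : ConnectedComponents C` of the cut `C` (a *black hole on `C`* in Hawking–Ellis' language;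
  `carrier_mk`: it is `connectedComponentIn C p`), with the partition API (`iUnion_carrier`,
  `disjoint_carrier`, `carrier_injective`, `isConnected_carrier`) and finiteness of the number of
  components of a compact locally connected cut (`finite_connectedComponents`, Mathlib).
* `HorizonLineage.Descends J C C' K K'`: the later component `K'` **descends from** `K` —
  `J(K) ∩ K' ≠ ∅`, verbatim the relation of Prop. 9.2.5 / 9.2.7.
* `HorizonLineage J C C'` (a `Prop`-valued structure): every component of `C` has **exactly one**
  descendant in `C'` (`exists_descends`: coverage, "every hole reaches the later slice";
  `descends_unique`: no bifurcation). `HorizonLineage.of_forall_isPreconnected` is Hawking–Ellis'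
  proof of Prop. 9.2.5 in this vocabulary: it suffices that each `J(K) ∩ C'` be nonempty and
  preconnected.
* `h.map : ConnectedComponents C → ConnectedComponents C'`, the **lineage map** (`map_eq_iff`,
  `inter_subset_carrier_map`: `J(K) ∩ C' ⊆ h.map K`), its fibres `h.fiber K'` (the earlier holes
  flowing into `K'`), the **merger partition** `h.partition = Setoid.ker h.map` of the components of
  `C` ("end in the same component of `C'`", an element of the complete lattice
  `Setoid (ConnectedComponents C)`), births and mergers as failure of surjectivity / injectivity
  (`surjective_map_iff`, `injective_map_iff`) with the census inequalities
  (`natCard_le_of_surjective_map`, …), and the **chain rule** `map_comp` /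
  `partition_le`: for three cuts `C, C', C''` the lineage `C → C''` factors through `C'` and the
  merger partitions increase with the later cut — proved from monotonicity and transitivity of `J`
  and coverage of `C'` by `C''`; specialised to the causal future of a `Spacetime` in
  `Spacetime.horizonLineage_map_comp` / `Spacetime.horizonLineage_partition_le` (transitivity of
  `J⁺` is `LorentzianMetric.causalFuture_causalFuture_eq`).
* `HorizonLineage.AreaLaw J C C' area`: the conclusion of Prop. 9.2.7 as a predicate — for every
  later component `K'`, `∑_{K : Descends K K'} area K ≤ area K'` (an unconditional `tsum` in
  `ℝ≥0∞`); consequences proved here: `AreaLaw.area_le`, `AreaLaw.finset_sum_le`,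
  `AreaLaw.tsum_le_tsum` (the total area of the components is non-decreasing along a lineage),
  `AreaLaw.toReal_sum_le`.
* `irreducibleMass A = √(A / 16π)` (Christodoulou–Ruffini 1971; Carroll 2019, eq. (6.110)
  `M_irr² = A / 16π`), the mass vector `HorizonLineage.massVector area C` of a cut, the
  **ℓ²-over-blocks cost** `blockCost m c = ∑ⱼ √(∑_{c i = j} (m i)²)` of a real vector `m` under a
  block map `c` (the middle term of the partition sandwich `‖m‖₂ ≤ blockCost m c ≤ ‖m‖₁` used by
  route `MergerLatticeBudget`, stated there over `Fin n → Fin p`), the cost `h.cost area` of a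
  lineage (block map `= h.map`), and the translation of the area law into irreducible masses:
  `sqrt_sum_irreducibleMass_sq_le`, `AreaLaw.sqrt_sum_massVector_sq_le` (the ℓ² norm of the masses
  flowing into `K'` is at most `m_irr(K')`) and `AreaLaw.cost_le` (`h.cost ≤ ‖m(C')‖₁`).

## Design choices

* *Abstract carrier.* Nothing here uses a metric: the lineage structure is a statement about a
  closure-like operator `J` and the connected components of two subsets, and the area law is a
  statement about a set function. The GR content — that cuts of an event horizon of a
  development with complete `𝓘⁺` form a `HorizonLineage` for `J = J⁺` (Hawking–Ellis Prop. 9.2.5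
  with property (c) of Prop. 9.2.3) and satisfy `AreaLaw` for the induced area (Prop. 9.2.7;
  Chruściel–Delay–Galloway–Howard Thm. 1.1/6.1) — is *not* asserted in this file: it belongs with the
  event-horizon vocabulary (`defn-EventHorizonCuts`) as named facts or theorems whose conclusions
  are the predicates defined here. In particular no named fact is introduced by this file.
* *Components as a quotient type.* Components of a cut are `ConnectedComponents ↥C` (Mathlib), so
  that "the number of black holes on `C`" is `Nat.card (ConnectedComponents C)`, finite for compact
  locally connected cuts by a Mathlib instance, and vectors "over the components" are functions on
  this type; `carrier` recovers the subsets of `M`.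
* *Which cut, and generators.* For Hawking–Ellis `C = ℬ(τ)` is the black-hole *region* of the
  slice and areas are those of `∂ℬᵢ(τ)`; the route wants `C = 𝓗⁺ ∩ Σ`, the horizon cut itself,
  whose components are the `∂ℬᵢ(τ)` when these are connected (Prop. 9.2.6, under Hawking–Ellis'
  conditions (α), (β)). Both are instances of the same abstract structure; `area` is an argument.
  The descent relation is stated with `J = J⁺` rather than with the null generators of the
  horizon: Hawking–Ellis themselves pass from "`J⁺(ℬᵢ(τ')) ∩ ℬ₁(τ) ≠ ∅`" to "the generators
  which intersect `𝒮(τ')` in `∂ℬᵢ(τ')` must intersect `𝒮(τ)` in `∂ℬ₁(τ)`" in the proof of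
  Prop. 9.2.7 (p. 319, by property (c) of Prop. 9.2.3 and Prop. 9.2.5), so nothing about
  generators is needed to *state* lineages and the area law.
* *The lineage map is by choice* from `exists_descends`; it is unique (`map_eq_iff`), so nothing
  depends on the choice.

## What is not here

* The event horizon of a Cauchy development, its cuts and their areas, the CDGH area theorem and
  "trapped surfaces lie behind the horizon" (request `defn-EventHorizonCuts`).
* The partition sandwich `‖m‖₂ ≤ blockCost m c ≤ ‖m‖₁` itself (a route item, `PartitionSandwich`,
  over `Fin n → Fin p`; transport to the finite types used here is `Fintype.equivFin`).
* Multiplicity of generators (Chruściel–Delay–Galloway–Howard's `N(p, S)`-weighted area): the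
  area law here compares plain areas, as in their Thm. 1.1 and Hawking–Ellis Prop. 9.2.7.

## References

* S. W. Hawking, G. F. R. Ellis, *The large scale structure of space-time*, CUP 1973, §9.2:
  p. 315 (black holes on `𝒮(τ)`), Prop. 9.2.5 (no bifurcation), Prop. 9.2.6, Prop. 9.2.7 (area
  law per lineage).
* P. T. Chruściel, E. Delay, G. J. Galloway, R. Howard, *Regularity of horizons and the area
  theorem*, Ann. Henri Poincaré 2 (2001) 109–178, Thm. 1.1, Thm. 6.1 (arXiv:gr-qc/0001003).
* D. Christodoulou, R. Ruffini, *Reversible transformations of a charged black hole*, Phys. Rev.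
  D 4 (1971) 3552–3555 (irreducible mass).
* S. M. Carroll, *Spacetime and geometry*, CUP 2019, §6.7, eq. (6.110) (`M_irr² = A/16π`).
-/

noncomputable section

open Set Function
open scoped ENNReal

universe u

namespace Literature.Geometry.Lorentzian

variable {M : Type*} [TopologicalSpace M]

namespace HorizonLineage

section Carrier

/-! ### Components of a cut and their carriers -/

/-- The **carrier** of the component `K` of the cut `C ⊆ M`: the subset of `M` underlying the
connected component `K : ConnectedComponents C` of the subspace `C` — a *black hole on the slice*
when `C = ℬ(τ)` (Hawking–Ellis 1973, §9.2, p. 315: "a connected component of the set `ℬ(τ)`"), a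
component of the horizon cut when `C = 𝓗⁺ ∩ Σ`. [cite: HawkingEllis1973, §9.2 p. 315] -/
def carrier (C : Set M) (K : ConnectedComponents C) : Set M :=
  ((↑) : C → M) '' (ConnectedComponents.mk ⁻¹' {K})

variable {C : Set M}

/-- Membership in a carrier: `q ∈ carrier C K` iff `q ∈ C` and its component is `K`. [folklore] -/
theorem mem_carrier_iff {K : ConnectedComponents C} {q : M} :
    q ∈ carrier C K ↔ ∃ hq : q ∈ C, ConnectedComponents.mk (⟨q, hq⟩ : C) = K := by
  constructor
  · rintro ⟨x, hx, rfl⟩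
    exact ⟨x.2, hx⟩
  · rintro ⟨hq, hK⟩
    exact ⟨⟨q, hq⟩, hK, rfl⟩

variable (C) in
/-- A carrier is part of the cut. [folklore] -/
theorem carrier_subset (K : ConnectedComponents C) : carrier C K ⊆ C := by
  rintro _ ⟨x, -, rfl⟩
  exact x.2

/-- A point of the cut lies in the carrier of its own component. [folklore] -/
theorem mem_carrier_mk (p : C) : (p : M) ∈ carrier C (ConnectedComponents.mk p) :=
  ⟨p, rfl, rfl⟩

/-- The carrier of the component of `p ∈ C` is the connected component of `p` in `C`
(`connectedComponentIn`). [folklore] -/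
theorem carrier_mk (p : C) :
    carrier C (ConnectedComponents.mk p) = connectedComponentIn C (p : M) := by
  rw [connectedComponentIn_eq_image p.2, carrier]
  congr 1
  ext q
  simp only [mem_preimage, mem_singleton_iff, ConnectedComponents.coe_eq_coe', Subtype.coe_eta]

/-- The carrier of the component containing `q` is the connected component of `q` in `C`.
[folklore] -/
theorem carrier_eq_connectedComponentIn {K : ConnectedComponents C} {q : M} (hq : q ∈ carrier C K) :
    carrier C K = connectedComponentIn C q := by
  obtain ⟨hqC, rfl⟩ := mem_carrier_iff.1 hq
  exact carrier_mk _

/-- Carriers are nonempty. [folklore] -/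
theorem carrier_nonempty (K : ConnectedComponents C) : (carrier C K).Nonempty := by
  obtain ⟨p, rfl⟩ := ConnectedComponents.surjective_coe K
  exact ⟨p, mem_carrier_mk p⟩

/-- Carriers are connected. [folklore] -/
theorem isConnected_carrier (K : ConnectedComponents C) : IsConnected (carrier C K) := by
  obtain ⟨p, rfl⟩ := ConnectedComponents.surjective_coe K
  rw [carrier_mk]
  exact isConnected_connectedComponentIn_iff.2 p.2

variable (C) in
/-- Distinct components have distinct carriers. [folklore] -/
theorem carrier_injective : Injective (carrier C) := by
  intro K L hKL
  obtain ⟨p, rfl⟩ := ConnectedComponents.surjective_coe K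
  have hp : (p : M) ∈ carrier C L := hKL ▸ mem_carrier_mk p
  obtain ⟨hpC, hL⟩ := mem_carrier_iff.1 hp
  exact hL

/-- Distinct components have disjoint carriers. [folklore] -/
theorem disjoint_carrier {K L : ConnectedComponents C} (h : K ≠ L) :
    Disjoint (carrier C K) (carrier C L) := by
  refine Set.disjoint_left.2 fun q hqK hqL ↦ h ?_
  obtain ⟨hq, rfl⟩ := mem_carrier_iff.1 hqK
  obtain ⟨hq', rfl⟩ := mem_carrier_iff.1 hqL
  rfl

/-- Two components whose carriers meet are equal. [folklore] -/
theorem eq_of_mem_carrier {K L : ConnectedComponents C} {q : M} (hqK : q ∈ carrier C K)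
    (hqL : q ∈ carrier C L) : K = L :=
  not_ne_iff.1 fun h ↦ Set.disjoint_left.1 (disjoint_carrier h) hqK hqL

variable (C) in
/-- The carriers of the components cover the cut. [folklore] -/
theorem iUnion_carrier : ⋃ K, carrier C K = C := by
  ext q
  simp only [mem_iUnion, mem_carrier_iff]
  exact ⟨fun ⟨_, hq, _⟩ ↦ hq, fun hq ↦ ⟨_, hq, rfl⟩⟩

/-- A compact, locally connected cut has finitely many components (finitely many black holes on
a slice; Mathlib's instance for compact locally connected spaces). [folklore] -/
theorem finite_connectedComponents (hC : IsCompact C) [LocallyConnectedSpace C] :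
    Finite (ConnectedComponents C) := by
  haveI : CompactSpace C := isCompact_iff_compactSpace.1 hC
  infer_instance

end Carrier

section Descends

/-! ### Descent between the components of two cuts -/

variable (J : Set M → Set M) (C C' : Set M)

/-- The component `K'` of the later cut `C'` **descends from** the component `K` of the earlier
cut `C` (equivalently, `K` *flows into* `K'`): the `J`-future of (the carrier of) `K` meets
`K'`, `J(K) ∩ K' ≠ ∅`. With `J = J⁺` this is verbatim the relation of Hawking–Ellis 1973,
Prop. 9.2.5 ("`ℬ₂(τ₂)` intersects `J⁺(ℬ₁(τ₁))`") and Prop. 9.2.7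
("`J⁺(ℬᵢ(τ')) ∩ ℬ₁(τ) ≠ ∅`"). [cite: HawkingEllis1973, §9.2 Prop. 9.2.5] -/
def Descends (K : ConnectedComponents C) (K' : ConnectedComponents C') : Prop :=
  (J (carrier C K) ∩ carrier C' K').Nonempty

variable {J C C'}

/-- Unfolding lemma for `Descends`. [folklore] -/
theorem descends_iff {K : ConnectedComponents C} {K' : ConnectedComponents C'} :
    Descends J C C' K K' ↔ ∃ q, q ∈ J (carrier C K) ∧ q ∈ carrier C' K' :=
  Iff.rfl

/-- A point of `C'` in the `J`-future of `K` witnesses that its component descends from `K`.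
[folklore] -/
theorem Descends.of_mem {K : ConnectedComponents C} {q : M} (hqJ : q ∈ J (carrier C K))
    (hq : q ∈ C') : Descends J C C' K (ConnectedComponents.mk ⟨q, hq⟩) :=
  ⟨q, hqJ, mem_carrier_mk _⟩

end Descends

end HorizonLineage

/-- A **horizon lineage** from the cut `C` to the later cut `C'` along `J`: every component `K`
of `C` has **exactly one** descendant among the components of `C'` —
`exists_descends` (*coverage*: the `J`-future of every component of `C` meets `C'`; for slices
of a future asymptotically predictable development, property (c) of Hawking–Ellis 1973,
Prop. 9.2.3: every future-inextendible timelike curve from `ℬ₁(τ₁)` meets `𝒮(τ₂)`) and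
`descends_unique` (*black holes can never bifurcate*, Hawking–Ellis 1973, Prop. 9.2.5: if
`ℬ₂(τ₂)` and `ℬ₃(τ₂)` both intersect `J⁺(ℬ₁(τ₁))` then `ℬ₂(τ₂) = ℬ₃(τ₂)`). Mergers (several `K`
with the same descendant) and births (components of `C'` descending from nothing) are allowed.
The structure is a hypothesis on `(J, C, C')`; that horizon cuts of a development satisfy it is
Prop. 9.2.5, to be supplied with the event-horizon vocabulary.
[cite: HawkingEllis1973, §9.2 Prop. 9.2.5] -/
structure HorizonLineage (J : Set M → Set M) (C C' : Set M) : Prop where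
  /-- Coverage: every component of `C` has a descendant in `C'`. -/
  exists_descends : ∀ K : ConnectedComponents C, ∃ K' : ConnectedComponents C',
    HorizonLineage.Descends J C C' K K'
  /-- No bifurcation (Hawking–Ellis 1973, Prop. 9.2.5): the descendant is unique. -/
  descends_unique : ∀ ⦃K : ConnectedComponents C⦄ ⦃K₁' K₂' : ConnectedComponents C'⦄,
    HorizonLineage.Descends J C C' K K₁' → HorizonLineage.Descends J C C' K K₂' → K₁' = K₂'

namespace HorizonLineage

section Basic

variable {J : Set M → Set M} {C C' C'' : Set M}

/-- Each component of the earlier cut has exactly one descendant. [cite: HawkingEllis1973, §9.2 Prop. 9.2.5] -/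
theorem existsUnique_descends (h : HorizonLineage J C C') (K : ConnectedComponents C) :
    ∃! K' : ConnectedComponents C', Descends J C C' K K' := by
  obtain ⟨K', hK'⟩ := h.exists_descends K
  exact ⟨K', hK', fun K'' hK'' ↦ h.descends_unique hK'' hK'⟩

/-- **Hawking–Ellis' proof of Prop. 9.2.5, abstract form.** If the `J`-future of every component
`K` of `C` meets `C'` in a nonempty *preconnected* set, then `(J, C, C')` is a horizon lineage:
`J(K) ∩ C'` lies inside a single component of `C'` ("`J⁺(ℬ₁(τ₁)) ∩ 𝒮(τ₂)` is connected, and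
will be contained in a connected component of `ℬ(τ₂)`", Hawking–Ellis 1973, p. 316).
[cite: HawkingEllis1973, §9.2 Prop. 9.2.5] -/
theorem of_forall_isPreconnected
    (hne : ∀ K : ConnectedComponents C, (J (carrier C K) ∩ C').Nonempty)
    (hconn : ∀ K : ConnectedComponents C, IsPreconnected (J (carrier C K) ∩ C')) :
    HorizonLineage J C C' where
  exists_descends K := by
    obtain ⟨q, hqJ, hq⟩ := hne K
    exact ⟨_, Descends.of_mem hqJ hq⟩
  descends_unique := by
    intro K K₁' K₂' h₁ h₂
    obtain ⟨q₁, hq₁J, hq₁⟩ := h₁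
    obtain ⟨q₂, hq₂J, hq₂⟩ := h₂
    have hsub : J (carrier C K) ∩ C' ⊆ connectedComponentIn C' q₁ :=
      (hconn K).subset_connectedComponentIn ⟨hq₁J, carrier_subset C' K₁' hq₁⟩ inter_subset_right
    have hq₂' : q₂ ∈ carrier C' K₁' := by
      rw [carrier_eq_connectedComponentIn hq₁]
      exact hsub ⟨hq₂J, carrier_subset C' K₂' hq₂⟩
    exact eq_of_mem_carrier hq₂' hq₂

/-! ### The lineage map, its fibres and the merger partition -/

/-- The **lineage map** of a horizon lineage: the component of the later cut `C'` descending
from the component `K` of `C` (the black hole on the later slice into which `K` has evolved,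
possibly by merging with others; Hawking–Ellis 1973, §9.2, Prop. 9.2.5). Defined by choice from
`exists_descends`; characterised by `map_eq_iff`. [cite: HawkingEllis1973, §9.2 Prop. 9.2.5] -/
def map (h : HorizonLineage J C C') (K : ConnectedComponents C) : ConnectedComponents C' :=
  Classical.choose (h.exists_descends K)

/-- `h.map K` descends from `K`. [folklore] -/
theorem descends_map (h : HorizonLineage J C C') (K : ConnectedComponents C) :
    Descends J C C' K (h.map K) :=
  Classical.choose_spec (h.exists_descends K)

/-- **Characterisation of the lineage map**: `h.map K = K'` iff `K'` descends from `K`.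
[cite: HawkingEllis1973, §9.2 Prop. 9.2.5] -/
theorem map_eq_iff (h : HorizonLineage J C C') {K : ConnectedComponents C}
    {K' : ConnectedComponents C'} : h.map K = K' ↔ Descends J C C' K K' :=
  ⟨fun e ↦ e ▸ h.descends_map K, fun d ↦ h.descends_unique (h.descends_map K) d⟩

/-- A descendant is the value of the lineage map. [folklore] -/
theorem map_eq_of_descends (h : HorizonLineage J C C') {K : ConnectedComponents C}
    {K' : ConnectedComponents C'} (d : Descends J C C' K K') : h.map K = K' :=
  h.map_eq_iff.2 d

/-- A point of `C'` in the future of `K` lies in the component `h.map K`. [folklore] -/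
theorem map_eq_mk_of_mem (h : HorizonLineage J C C') {K : ConnectedComponents C} {q : M}
    (hqJ : q ∈ J (carrier C K)) (hq : q ∈ C') : h.map K = ConnectedComponents.mk ⟨q, hq⟩ :=
  h.map_eq_of_descends (Descends.of_mem hqJ hq)

/-- **The future of a hole through the later cut lies in its descendant**:
`J(K) ∩ C' ⊆ h.map K` (Hawking–Ellis 1973, proof of Prop. 9.2.5: `J⁺(ℬ₁(τ₁)) ∩ 𝒮(τ₂)` "will be
contained in a connected component of `ℬ(τ₂)`"). [cite: HawkingEllis1973, §9.2 Prop. 9.2.5] -/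
theorem inter_subset_carrier_map (h : HorizonLineage J C C') (K : ConnectedComponents C) :
    J (carrier C K) ∩ C' ⊆ carrier C' (h.map K) := by
  rintro q ⟨hqJ, hq⟩
  rw [h.map_eq_mk_of_mem hqJ hq]
  exact mem_carrier_mk _

/-- The **fibre** of the lineage over the later component `K'`: the components of the earlier cut
flowing into `K'` (the `ℬᵢ(τ')` of Hawking–Ellis 1973, Prop. 9.2.7). [cite: HawkingEllis1973, §9.2 Prop. 9.2.7] -/
abbrev fiber (h : HorizonLineage J C C') (K' : ConnectedComponents C') :
    Set (ConnectedComponents C) :=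
  h.map ⁻¹' {K'}

/-- Membership in a fibre is descent. [folklore] -/
theorem mem_fiber_iff (h : HorizonLineage J C C') {K : ConnectedComponents C}
    {K' : ConnectedComponents C'} : K ∈ h.fiber K' ↔ Descends J C C' K K' := by
  simp only [mem_preimage, mem_singleton_iff, h.map_eq_iff]

/-- The fibre over `K'` is the set of components from which `K'` descends. [folklore] -/
theorem fiber_eq (h : HorizonLineage J C C') (K' : ConnectedComponents C') :
    h.fiber K' = {K | Descends J C C' K K'} :=
  Set.ext fun _ ↦ h.mem_fiber_iff

/-- The **merger partition** of the components of the earlier cut induced by the later cut: two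
components are equivalent iff they have the same descendant ("end in the same component of
`C'`"), i.e. the kernel of the lineage map, an element of the complete lattice
`Setoid (ConnectedComponents C)` of partitions. Hawking–Ellis 1973, §9.2 (black holes "can merge
together"). [cite: HawkingEllis1973, §9.2 Prop. 9.2.5] -/
def partition (h : HorizonLineage J C C') : Setoid (ConnectedComponents C) :=
  Setoid.ker h.map

/-- Unfolding lemma for the merger partition. [folklore] -/
theorem partition_iff (h : HorizonLineage J C C') {K₁ K₂ : ConnectedComponents C} :
    h.partition K₁ K₂ ↔ h.map K₁ = h.map K₂ :=
  Setoid.ker_def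

/-- Two earlier components are merged by `C'` iff some later component descends from both.
[folklore] -/
theorem partition_iff_exists (h : HorizonLineage J C C') {K₁ K₂ : ConnectedComponents C} :
    h.partition K₁ K₂ ↔ ∃ K', Descends J C C' K₁ K' ∧ Descends J C C' K₂ K' := by
  rw [partition_iff]
  constructor
  · intro e
    exact ⟨h.map K₂, e ▸ h.descends_map K₁, h.descends_map K₂⟩
  · rintro ⟨K', h₁, h₂⟩
    rw [h.map_eq_of_descends h₁, h.map_eq_of_descends h₂]

/-! ### Births, mergers and the census along a lineage -/

/-- **No births** between `C` and `C'` iff the lineage map is surjective: every later component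
descends from an earlier one (Hawking–Ellis 1973, §9.2: "new black holes can form as the result of
further bodies collapsing"). [cite: HawkingEllis1973, §9.2 Prop. 9.2.5] -/
theorem surjective_map_iff (h : HorizonLineage J C C') :
    Surjective h.map ↔ ∀ K' : ConnectedComponents C', ∃ K, Descends J C C' K K' := by
  simp only [Function.Surjective, h.map_eq_iff]

/-- **No mergers** between `C` and `C'` iff the lineage map is injective: no later component
descends from two distinct earlier ones (Hawking–Ellis 1973, §9.2: "black holes can merge
together"). [cite: HawkingEllis1973, §9.2 Prop. 9.2.5] -/
theorem injective_map_iff (h : HorizonLineage J C C') :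
    Injective h.map ↔ ∀ ⦃K₁ K₂ : ConnectedComponents C⦄ ⦃K' : ConnectedComponents C'⦄,
      Descends J C C' K₁ K' → Descends J C C' K₂ K' → K₁ = K₂ := by
  constructor
  · intro hi K₁ K₂ K' h₁ h₂
    exact hi ((h.map_eq_of_descends h₁).trans (h.map_eq_of_descends h₂).symm)
  · intro H K₁ K₂ e
    exact H (h.descends_map K₁) (by rw [e]; exact h.descends_map K₂)

/-- Without births the number of components (black holes) does not increase from `C` to `C'`.
[folklore] -/
theorem natCard_le_of_surjective_map [Finite (ConnectedComponents C)] (h : HorizonLineage J C C')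
    (hs : Surjective h.map) :
    Nat.card (ConnectedComponents C') ≤ Nat.card (ConnectedComponents C) :=
  Nat.card_le_card_of_surjective h.map hs

/-- Without mergers the number of components does not decrease from `C` to `C'`. [folklore] -/
theorem natCard_le_of_injective_map [Finite (ConnectedComponents C')] (h : HorizonLineage J C C')
    (hi : Injective h.map) :
    Nat.card (ConnectedComponents C) ≤ Nat.card (ConnectedComponents C') :=
  Nat.card_le_card_of_injective h.map hi

/-- With neither births nor mergers the census is constant from `C` to `C'`. [folklore] -/
theorem natCard_eq_of_bijective_map (h : HorizonLineage J C C') (hb : Bijective h.map) :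
    Nat.card (ConnectedComponents C) = Nat.card (ConnectedComponents C') :=
  Nat.card_congr (Equiv.ofBijective h.map hb)

/-! ### Chains of cuts: the lineage maps compose and the merger partitions increase -/

/-- **Chain rule for lineages.** For three cuts `C`, `C'`, `C''` carrying horizon lineages
`C → C'`, `C' → C''`, `C → C''` along a monotone, transitive `J` (`J ∘ J ⊆ J`) such that the
`J`-future of every *point* of `C'` meets `C''` (coverage), the lineage `C → C''` factors:
`map (C → C'') = map (C' → C'') ∘ map (C → C')`. Proof: if `q ∈ J(K) ∩ h₁.map K` and
`s ∈ J(q) ∩ C''`, then `s ∈ J(K)` and `s ∈ J(h₁.map K)`, so the component of `s` is both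
`h₃.map K` and `h₂.map (h₁.map K)`. [folklore] -/
theorem map_comp (hJm : Monotone J) (hJt : ∀ S, J (J S) ⊆ J S)
    (hcov : ∀ q ∈ C', (J {q} ∩ C'').Nonempty)
    (h₁ : HorizonLineage J C C') (h₂ : HorizonLineage J C' C'') (h₃ : HorizonLineage J C C'') :
    h₃.map = h₂.map ∘ h₁.map := by
  funext K
  obtain ⟨q, hqJ, hqK'⟩ := h₁.descends_map K
  obtain ⟨s, hsq, hs⟩ := hcov q (carrier_subset C' _ hqK')
  have hsK : s ∈ J (carrier C K) := hJt _ (hJm (singleton_subset_iff.2 hqJ) hsq)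
  have hsK' : s ∈ J (carrier C' (h₁.map K)) := hJm (singleton_subset_iff.2 hqK') hsq
  rw [Function.comp_apply, h₃.map_eq_mk_of_mem hsK hs, h₂.map_eq_mk_of_mem hsK' hs]

/-- **The merger partitions form a monotone chain**: under the hypotheses of `map_comp`, the
partition of the components of `C` induced by `C'` is finer than the one induced by the later cut
`C''` (in the lattice `Setoid (ConnectedComponents C)`): holes merged before `C'` stay merged.
[folklore] -/
theorem partition_le (hJm : Monotone J) (hJt : ∀ S, J (J S) ⊆ J S)
    (hcov : ∀ q ∈ C', (J {q} ∩ C'').Nonempty)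
    (h₁ : HorizonLineage J C C') (h₂ : HorizonLineage J C' C'') (h₃ : HorizonLineage J C C'') :
    h₁.partition ≤ h₃.partition := by
  refine Setoid.le_def.2 fun {K₁ K₂} hK ↦ ?_
  rw [partition_iff] at hK ⊢
  rw [map_comp hJm hJt hcov h₁ h₂ h₃, Function.comp_apply, Function.comp_apply, hK]

end Basic

/-! ### The area law along a lineage -/

/-- The **area law along the lineage** from `C` to `C'` for the set function `area` (a
predicate on `(J, C, C', area)`): for every component `K'` of the later cut, the areas of the
earlier components flowing into it sum to at most its area,
`∑_{K : Descends K K'} area K ≤ area K'` — the conclusion of Hawking–Ellis 1973, Prop. 9.2.7 ("the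
area `A₁(τ)` of `∂ℬ₁(τ)` is greater than or equal to the sum of the areas `Aᵢ(τ')` of
`∂ℬᵢ(τ')`", over the earlier holes with `J⁺(ℬᵢ(τ')) ∩ ℬ₁(τ) ≠ ∅`), whose hypotheses (regular
predictable space, null energy condition; without differentiability assumptions on the horizon:
Chruściel–Delay–Galloway–Howard 2001, Thm. 1.1 and Thm. 6.1) live with the event-horizon
vocabulary. The sum is the unconditional `tsum` in `ℝ≥0∞`. [cite: HawkingEllis1973, §9.2 Prop. 9.2.7] -/
def AreaLaw (J : Set M → Set M) (C C' : Set M) (area : Set M → ℝ≥0∞) : Prop :=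
  ∀ K' : ConnectedComponents C',
    ∑' K : ↥{K : ConnectedComponents C | Descends J C C' K K'}, area (carrier C K) ≤
      area (carrier C' K')

namespace AreaLaw

variable {J : Set M → Set M} {C C' : Set M} {area : Set M → ℝ≥0∞}

/-- Under the area law a component has area at most that of its descendant ("the area of the
boundary of a black hole cannot decrease with time", Hawking–Ellis 1973, Prop. 9.2.7).
[cite: HawkingEllis1973, §9.2 Prop. 9.2.7] -/
theorem area_le (hA : AreaLaw J C C' area) {K : ConnectedComponents C}
    {K' : ConnectedComponents C'} (d : Descends J C C' K K') :
    area (carrier C K) ≤ area (carrier C' K') :=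
  (ENNReal.le_tsum (f := fun K : ↥{K : ConnectedComponents C | Descends J C C' K K'} ↦
    area (carrier C K)) ⟨K, d⟩).trans (hA K')

/-- Finite form of the area law: any finite set of earlier components flowing into `K'` has total
area at most `area K'`. [cite: HawkingEllis1973, §9.2 Prop. 9.2.7] -/
theorem finset_sum_le (hA : AreaLaw J C C' area) {K' : ConnectedComponents C'}
    (s : Finset (ConnectedComponents C)) (hs : ∀ K ∈ s, Descends J C C' K K') :
    ∑ K ∈ s, area (carrier C K) ≤ area (carrier C' K') :=
  calc ∑ K ∈ s, area (carrier C K)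
      = ∑' K : (s : Set (ConnectedComponents C)), area (carrier C K) :=
        (Finset.tsum_subtype' s fun K ↦ area (carrier C K)).symm
    _ ≤ ∑' K : ↥{K : ConnectedComponents C | Descends J C C' K K'}, area (carrier C K) :=
        ENNReal.tsum_mono_subtype (fun K ↦ area (carrier C K)) fun K hK ↦ hs K hK
    _ ≤ area (carrier C' K') := hA K'

/-- The area law over the fibres of the lineage map. [cite: HawkingEllis1973, §9.2 Prop. 9.2.7] -/
theorem tsum_fiber_le (hA : AreaLaw J C C' area) (h : HorizonLineage J C C')
    (K' : ConnectedComponents C') :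
    ∑' K : h.fiber K', area (carrier C K) ≤ area (carrier C' K') := by
  rw [h.fiber_eq]
  exact hA K'

/-- **The total area of the components is non-decreasing along a horizon lineage**: regroup the
components of `C` by their descendants and apply the area law fibrewise (births only add).
Hawking–Ellis 1973, Prop. 9.2.7; Chruściel–Delay–Galloway–Howard 2001, Thm. 1.1
(`S₁ ⊂ J⁻(S₂) ⟹ Ar(S₁) ≤ Ar(S₂)`). [cite: HawkingEllis1973, §9.2 Prop. 9.2.7] -/
theorem tsum_le_tsum (hA : AreaLaw J C C' area) (h : HorizonLineage J C C') :
    ∑' K : ConnectedComponents C, area (carrier C K) ≤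
      ∑' K' : ConnectedComponents C', area (carrier C' K') :=
  calc ∑' K : ConnectedComponents C, area (carrier C K)
      = ∑' K' : ConnectedComponents C', ∑' K : h.map ⁻¹' {K'}, area (carrier C K) :=
        (ENNReal.tsum_fiberwise (fun K ↦ area (carrier C K)) h.map).symm
    _ ≤ ∑' K' : ConnectedComponents C', area (carrier C' K') :=
        ENNReal.tsum_le_tsum fun K' ↦ hA.tsum_fiber_le h K'

/-- Real-valued finite form of the area law (for a later component of finite area).
[cite: HawkingEllis1973, §9.2 Prop. 9.2.7] -/
theorem toReal_sum_le (hA : AreaLaw J C C' area) {K' : ConnectedComponents C'}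
    (s : Finset (ConnectedComponents C)) (hs : ∀ K ∈ s, Descends J C C' K K')
    (hfin : area (carrier C' K') ≠ ∞) :
    ∑ K ∈ s, (area (carrier C K)).toReal ≤ (area (carrier C' K')).toReal := by
  have hle := hA.finset_sum_le s hs
  have hfinK : ∀ K ∈ s, area (carrier C K) ≠ ∞ := fun K hK ↦
    ne_top_of_le_ne_top hfin ((Finset.single_le_sum (fun _ _ ↦ zero_le) hK).trans hle)
  rw [← ENNReal.toReal_sum hfinK]
  exact ENNReal.toReal_mono hfin hle

end AreaLaw

end HorizonLineage

/-! ### Irreducible masses and the ℓ²-over-blocks cost -/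

/-- The **irreducible mass** of a horizon (component) of area `A`: `m_irr(A) = √(A / 16π)`, so
that `A = 16π m_irr²` (a Schwarzschild horizon of mass `m` has area `16π m²`). Christodoulou–Ruffini
1971; Carroll 2019, §6.7, eq. (6.110) (`M_irr² = A / 16π G²`, here `G = 1`). For `A < 0` this is
the junk value `0` of `Real.sqrt`. [cite: Carroll2019, §6.7 eq. (6.110)] -/
def irreducibleMass (A : ℝ) : ℝ :=
  Real.sqrt (A / (16 * Real.pi))

/-- Unfolding lemma for `irreducibleMass`. [folklore] -/
theorem irreducibleMass_def (A : ℝ) : irreducibleMass A = Real.sqrt (A / (16 * Real.pi)) := rfl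

/-- Irreducible masses are nonnegative. [folklore] -/
theorem irreducibleMass_nonneg (A : ℝ) : 0 ≤ irreducibleMass A :=
  Real.sqrt_nonneg _

/-- `m_irr(A)² = A / 16π` for `A ≥ 0`. Carroll 2019, eq. (6.110). [cite: Carroll2019, §6.7 eq. (6.110)] -/
theorem irreducibleMass_sq {A : ℝ} (hA : 0 ≤ A) : irreducibleMass A ^ 2 = A / (16 * Real.pi) :=
  Real.sq_sqrt (div_nonneg hA (by positivity))

/-- `16π m_irr(A)² = A` for `A ≥ 0`. Carroll 2019, eq. (6.110). [cite: Carroll2019, §6.7 eq. (6.110)] -/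
theorem sixteen_pi_mul_irreducibleMass_sq {A : ℝ} (hA : 0 ≤ A) :
    16 * Real.pi * irreducibleMass A ^ 2 = A := by
  rw [irreducibleMass_sq hA]
  field_simp

/-- The irreducible mass is monotone in the area. [folklore] -/
theorem irreducibleMass_mono : Monotone irreducibleMass := by
  intro A B h
  unfold irreducibleMass
  exact Real.sqrt_le_sqrt (by gcongr)

/-- `m_irr(A) ≤ m` iff `A ≤ 16π m²`, for `m ≥ 0`. [folklore] -/
theorem irreducibleMass_le_iff {A m : ℝ} (hm : 0 ≤ m) :
    irreducibleMass A ≤ m ↔ A ≤ 16 * Real.pi * m ^ 2 := by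
  rw [irreducibleMass, Real.sqrt_le_left hm, div_le_iff₀ (by positivity), mul_comm]

/-- The Schwarzschild horizon of mass `m ≥ 0` (area `16π m²`) has irreducible mass `m`.
Carroll 2019, §6.7 (eq. (6.110) with `a = 0`). [cite: Carroll2019, §6.7 eq. (6.110)] -/
theorem irreducibleMass_schwarzschild {m : ℝ} (hm : 0 ≤ m) :
    irreducibleMass (16 * Real.pi * m ^ 2) = m := by
  have hπ : (16 * Real.pi) ≠ 0 := by positivity
  rw [irreducibleMass, mul_div_cancel_left₀ (m ^ 2) hπ]
  exact Real.sqrt_sq hm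

/-- **The area law in irreducible masses is an ℓ² law**: if nonnegative areas `A i`, `i ∈ s`, sum
to at most `A'`, then the ℓ² norm of their irreducible masses is at most `m_irr(A')`
(`∑ m_irr(Aᵢ)² = ∑ Aᵢ / 16π ≤ A' / 16π = m_irr(A')²`). [folklore] -/
theorem sqrt_sum_irreducibleMass_sq_le {ι : Type*} (s : Finset ι) {A : ι → ℝ} {A' : ℝ}
    (hA : ∀ i ∈ s, 0 ≤ A i) (h : ∑ i ∈ s, A i ≤ A') :
    Real.sqrt (∑ i ∈ s, irreducibleMass (A i) ^ 2) ≤ irreducibleMass A' := by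
  have hs : ∑ i ∈ s, irreducibleMass (A i) ^ 2 = (∑ i ∈ s, A i) / (16 * Real.pi) := by
    rw [Finset.sum_div]
    exact Finset.sum_congr rfl fun i hi ↦ irreducibleMass_sq (hA i hi)
  rw [hs, irreducibleMass]
  exact Real.sqrt_le_sqrt (by gcongr)

/-- The **ℓ²-over-blocks cost** of the real vector `m : ι → ℝ` under the block map `c : ι → κ`:
`∑ⱼ √(∑_{i : c i = j} (m i)²)`, the sum over the blocks of the ℓ² norms of the restrictions of `m`
(empty blocks contribute `0`). It interpolates between `‖m‖₂` (one block) and `‖m‖₁` (singleton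
blocks) — the "partition sandwich" of route `MergerLatticeBudget` (Final State Conjecture), whose
middle term over `Fin n → Fin p` this is verbatim; with `m` the irreducible masses of the components
of a cut and `c` a lineage map it is the mass budget of the mergers. [folklore] -/
def blockCost {ι κ : Type*} [Fintype ι] [Fintype κ] [DecidableEq κ] (m : ι → ℝ) (c : ι → κ) : ℝ :=
  ∑ j, Real.sqrt (∑ i ∈ Finset.univ.filter (fun i ↦ c i = j), m i ^ 2)

section blockCost

variable {ι κ : Type*} [Fintype ι] [Fintype κ] [DecidableEq κ]

/-- Unfolding lemma for `blockCost`. [folklore] -/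
theorem blockCost_def (m : ι → ℝ) (c : ι → κ) :
    blockCost m c = ∑ j, Real.sqrt (∑ i ∈ Finset.univ.filter (fun i ↦ c i = j), m i ^ 2) :=
  rfl

/-- The block cost is nonnegative. [folklore] -/
theorem blockCost_nonneg (m : ι → ℝ) (c : ι → κ) : 0 ≤ blockCost m c :=
  Finset.sum_nonneg fun _ _ ↦ Real.sqrt_nonneg _

/-- Blockwise bounds add up: if the ℓ² norm of every block is at most `m' j`, the block cost is at
most `∑ⱼ m' j`. [folklore] -/
theorem blockCost_le_sum {m : ι → ℝ} {c : ι → κ} {m' : κ → ℝ}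
    (h : ∀ j, Real.sqrt (∑ i ∈ Finset.univ.filter (fun i ↦ c i = j), m i ^ 2) ≤ m' j) :
    blockCost m c ≤ ∑ j, m' j :=
  Finset.sum_le_sum fun j _ ↦ h j

end blockCost

namespace HorizonLineage

variable {J : Set M → Set M} {C C' : Set M}

/-- The **irreducible-mass vector of a cut**: `m(C) = (√(area Kᵢ / 16π))ᵢ` over the components
`Kᵢ` of `C` (infinite areas are sent to the junk value `m_irr(0) = 0` by `ENNReal.toReal`).
Christodoulou–Ruffini 1971; Carroll 2019, eq. (6.110). [cite: Carroll2019, §6.7 eq. (6.110)] -/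
def massVector (area : Set M → ℝ≥0∞) (C : Set M) (K : ConnectedComponents C) : ℝ :=
  irreducibleMass (area (carrier C K)).toReal

/-- Unfolding lemma for `massVector`. [folklore] -/
theorem massVector_apply (area : Set M → ℝ≥0∞) (C : Set M) (K : ConnectedComponents C) :
    massVector area C K = irreducibleMass (area (carrier C K)).toReal :=
  rfl

/-- The mass vector is nonnegative. [folklore] -/
theorem massVector_nonneg (area : Set M → ℝ≥0∞) (C : Set M) (K : ConnectedComponents C) :
    0 ≤ massVector area C K :=
  irreducibleMass_nonneg _

open scoped Classical in
/-- The **merger cost** of a horizon lineage between cuts with finitely many components: the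
ℓ²-over-blocks cost of the irreducible-mass vector of `C` for the blocks of the merger partition,
`∑_{K'} √(∑_{K ↦ K'} m_irr(K)²)` (block map = the lineage map). [folklore] -/
def cost [Fintype (ConnectedComponents C)] [Fintype (ConnectedComponents C')]
    (h : HorizonLineage J C C') (area : Set M → ℝ≥0∞) : ℝ :=
  blockCost (massVector area C) h.map

/-- Unfolding lemma for `cost` (any decidability instance). [folklore] -/
theorem cost_eq [Fintype (ConnectedComponents C)] [Fintype (ConnectedComponents C')]
    [DecidableEq (ConnectedComponents C')] (h : HorizonLineage J C C')
    (area : Set M → ℝ≥0∞) : h.cost area = blockCost (massVector area C) h.map := by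
  unfold cost
  convert rfl

/-- The merger cost is nonnegative. [folklore] -/
theorem cost_nonneg [Fintype (ConnectedComponents C)] [Fintype (ConnectedComponents C')]
    (h : HorizonLineage J C C') (area : Set M → ℝ≥0∞) : 0 ≤ h.cost area := by
  classical
  rw [cost_eq]
  exact blockCost_nonneg _ _

/-- **The area law in irreducible masses**: along a horizon lineage satisfying the area law, the
ℓ² norm of the irreducible masses of the earlier components flowing into a later component `K'`
of finite area is at most `m_irr(K')` (areas add under coalescence, so squared irreducible masses
are super-additive; Hawking–Ellis 1973, Prop. 9.2.7). [cite: HawkingEllis1973, §9.2 Prop. 9.2.7] -/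
theorem AreaLaw.sqrt_sum_massVector_sq_le [Fintype (ConnectedComponents C)]
    [DecidableEq (ConnectedComponents C')] {area : Set M → ℝ≥0∞} (hA : AreaLaw J C C' area)
    (h : HorizonLineage J C C') (K' : ConnectedComponents C') (hfin : area (carrier C' K') ≠ ∞) :
    Real.sqrt (∑ K ∈ Finset.univ.filter (fun K ↦ h.map K = K'), massVector area C K ^ 2) ≤
      massVector area C' K' := by
  unfold massVector
  refine sqrt_sum_irreducibleMass_sq_le _ (fun K _ ↦ ENNReal.toReal_nonneg) ?_
  refine hA.toReal_sum_le _ (fun K hK ↦ ?_) hfin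
  exact h.map_eq_iff.1 (Finset.mem_filter.1 hK).2

/-- **The merger cost is bounded by the ℓ¹ mass of the later cut**: along a horizon lineage
satisfying the area law, with finitely many components of finite area,
`h.cost ≤ ∑_{K'} m_irr(K')` (blockwise `AreaLaw.sqrt_sum_massVector_sq_le`; newborn components
only add). With the partition sandwich `‖m(C)‖₂ ≤ h.cost` this is the chain
`‖m(C)‖₂ ≤ h.cost ≤ ‖m(C')‖₁` of route `MergerLatticeBudget`. [cite: HawkingEllis1973, §9.2 Prop. 9.2.7] -/
theorem AreaLaw.cost_le [Fintype (ConnectedComponents C)] [Fintype (ConnectedComponents C')]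
    {area : Set M → ℝ≥0∞} (hA : AreaLaw J C C' area) (h : HorizonLineage J C C')
    (hfin : ∀ K' : ConnectedComponents C', area (carrier C' K') ≠ ∞) :
    h.cost area ≤ ∑ K', massVector area C' K' := by
  classical
  rw [cost_eq]
  exact blockCost_le_sum fun K' ↦ hA.sqrt_sum_massVector_sq_le h K' (hfin K')

end HorizonLineage

/-! ### Specialisation to the causal future of a spacetime -/

namespace Spacetime

variable {d : ℕ} (S : Spacetime.{u} d)

/-- Transitivity of the causal future of a spacetime in operator form: `J⁺(J⁺(T)) ⊆ J⁺(T)`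
(`LorentzianMetric.causalFuture_causalFuture_eq` on the boundaryless carrier). O'Neill 1983,
Ch. 14, p. 402. [folklore] -/
theorem causalFuture_causalFuture_subset (T : Set S.carrier) :
    S.metric.causalFuture S.timeOrientation (S.metric.causalFuture S.timeOrientation T) ⊆
      S.metric.causalFuture S.timeOrientation T := by
  have hn : (2 : WithTop ℕ∞) ≤ ((⊤ : ℕ∞) : WithTop ℕ∞) := WithTop.coe_le_coe.mpr le_top
  exact (LorentzianMetric.causalFuture_causalFuture_eq hn T).subset

/-- The causal future of a spacetime is a monotone operator. O'Neill 1983, Ch. 14, p. 402.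
[folklore] -/
theorem monotone_causalFuture : Monotone (S.metric.causalFuture S.timeOrientation) :=
  fun _ _ h ↦ LorentzianMetric.causalFuture_mono h

/-- **Chain rule for horizon lineages along `J⁺` of a spacetime**: for cuts `C`, `C'`, `C''`
carrying horizon lineages `C → C'`, `C' → C''`, `C → C''` along the causal future, with the causal
future of every point of `C'` meeting `C''`, the lineage maps compose (`HorizonLineage.map_comp`
with monotonicity and transitivity of `J⁺` discharged). [folklore] -/
theorem horizonLineage_map_comp {C C' C'' : Set S.carrier}
    (h₁ : HorizonLineage (S.metric.causalFuture S.timeOrientation) C C')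
    (h₂ : HorizonLineage (S.metric.causalFuture S.timeOrientation) C' C'')
    (h₃ : HorizonLineage (S.metric.causalFuture S.timeOrientation) C C'')
    (hcov : ∀ q ∈ C', (S.metric.causalFuture S.timeOrientation {q} ∩ C'').Nonempty) :
    h₃.map = h₂.map ∘ h₁.map :=
  HorizonLineage.map_comp S.monotone_causalFuture S.causalFuture_causalFuture_subset hcov h₁ h₂ h₃

/-- **Monotone chain of merger partitions along `J⁺` of a spacetime**: under the hypotheses of
`horizonLineage_map_comp`, the merger partition of the components of `C` induced by `C'` is finer
than the one induced by the later cut `C''`. [folklore] -/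
theorem horizonLineage_partition_le {C C' C'' : Set S.carrier}
    (h₁ : HorizonLineage (S.metric.causalFuture S.timeOrientation) C C')
    (h₂ : HorizonLineage (S.metric.causalFuture S.timeOrientation) C' C'')
    (h₃ : HorizonLineage (S.metric.causalFuture S.timeOrientation) C C'')
    (hcov : ∀ q ∈ C', (S.metric.causalFuture S.timeOrientation {q} ∩ C'').Nonempty) :
    h₁.partition ≤ h₃.partition :=
  HorizonLineage.partition_le S.monotone_causalFuture S.causalFuture_causalFuture_subset hcov
    h₁ h₂ h₃

end Spacetime

end Literature.Geometry.Lorentzian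

end
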